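import Summits.BirchSwinnertonDyer.BirchSwinnertonDyer.Theorems.AdditiveKolyvaginRoadLevelSystemsRigidityDichotomy
import HarnessLib

/-!
# Route `AdditiveKolyvaginRoad`, crux `LevelKolyvaginSystemsAdditive` (item stmt-BirchSwinnertonDyer-21396, KS′):
# CANONICAL LINES — the carrier's UPPER-LEVEL fields (`sign`, memberships, `relation` (8.1), `transport`, `baseCase`)
# are inhabited by rank bookkeeping alone, in ENGINE currency, from the two global-duality dichotomies (Bertolini–Darmon
# admissible primes in the LEVEL direction, Kolyvagin primes in the CONDUCTOR direction) — abstract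
# (cell `pub/bsd-wall`, width seat `bsd-wall-akr-p2x-w2` g6; `--supports stmt-BirchSwinnertonDyer-21396`, helper; conductor-direction
# companion of parts 1–4b of the level engine `…LevelSystemsRigidity{Core,,Dichotomy,Connected}`)

WHY. The carrier `LevelKolyvaginSystemP W K p Dt β ι c` of crux KS′ asks, ABOVE the bottom level `n = ∅`, for classes
`κ m n ∈ H¹(K, E[p])` (conductor `m` = finite set of Kolyvagin primes, level `n ≠ ∅` = finite set of admissible primes) lying in the
signed MIXED level space (`sign` ∕ `selmer_off` ∕ `selmer_inf` ∕ `toric_on` ∕ `transverse_on`), with W. Zhang's relation (8.1) read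
two-sidedly (`relation`: `loc_ℓ κ(mℓ, n) = 0 ⟺ loc_ℓ κ(m, n) = 0`), `transport` (Thm. 4.3, contrapositive form) and `baseCase` (Thm. 7.2:
`κ(∅, n) ≠ 0` at every non-empty even level of total canonical rank one); at `n = ∅` it asks only for realisation by Kolyvagin–Heegner
data and ONE seed (the tree's hybrid socket `AdditiveKoly.nonempty_levelKolyvaginSystemP_of_upperLevels_of_bottomTransfer`). The
crux-triage finding (`Cruxes/LevelKolyvaginSystemsAdditive/TRIAGE-r1-1.md` v17 §1, seat cruxtriage-21396-1 g17) is that the upper-level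
rows carry no geometric content: they are inhabited by CANONICAL LINES — `κ(m, n) :=` a generator of the mixed space `Sel(m, n)` when its
TOTAL rank (both signs) is one (a CORE), `0` otherwise. THIS FILE proves that finding in ENGINE currency (bi-indexed level spaces
`Sel : Finset M → Finset Q → Bool → Submodule F H` over a field, «locally trivial above `ℓ` ∕ above `q`» predicates `TM`, `TQ` closed
under `0` and scalars), from:
* (Twin) Howard's dichotomy at a Kolyvagin prime `ℓ ∉ m` at a NON-EMPTY level in EACH sign (Compositio 140 (2004) Lemma 2.5.3): the
  smaller of `Sel(m, n)^μ`, `Sel(mℓ, n)^μ` is the locally-trivial-above-`ℓ` part of the larger, of codimension one, the larger being the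
  side with a class detected above `ℓ` (`hDrop`, `hRise`), and one side HAS such a class (`hJump` — the Poitou–Tate jump); E-side these
  are the tree's Kolyvagin-prime package (`KolyvaginLocalPackageP`: (REC), `perf`, `line`, isotropies) and `hjump_of_poitouTateP`;
* (Inert) ∕ (Lower) at an admissible prime `q ∉ n` for EACH conductor `m` (W. Zhang (9.2); Prop. 5.4, lowering half — Poitou–Tate free),
  the «in» bookkeeping, and the PARITY of the total rank at conductor `∅` (odd ⟺ even level; tree `odd_total_iff_even_card` for `SelQP`).
NO seed, NO Kolyvagin class, NO reciprocity law, NO (Raise) for mixed spaces and NO structure theorem for genuine classes is used: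
above the bottom level the carrier is bookkeeping (the conductor-`∅` rows of the BIPARTITE producer — laws (A)/(B) for `SelQP` from a
seed — are the triage seat's `K1CanonicalSelQP`, evidence #50 on the item; not needed for the carrier).
WHAT (namespace `…X11b.Three.Koly.CoreGraph`, as parts 1–4b): §0 parity bookkeeping; §1 one Kolyvagin step in one sign
(`twin_forall_triv_of_detected`, `twin_rank_cases`, `twin_bodd_eq_not`, `forall_triv_of_generator`); §2 `bodd_finrank_eq` — per-sign
rank PARITY along the conductor (`bodd dim Sel(m,n)^μ = bodd dim Sel(∅,n)^μ xor bodd #m`), `even_total_iff`; §3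
`not_triv_of_not_triv_canonical` — detection crosses a Kolyvagin step between canonical generators (the heart of (8.1) for canonical
lines) — and `exists_canonicalUpperLevels`, THE RESULT: `ε₀ : Finset Q → Bool` and `κ : Finset M → Finset Q → H` with, at every NON-EMPTY
level `n`: `κ m n ∈ Sel(m, n)^{ε₀ n xor bodd #m}` (the carrier's `sign` pattern, forced by §2), RELATION `TM ℓ (κ(mℓ, n)) ⟺ TM ℓ (κ(m, n))`
(`ℓ ∉ m`), TRANSPORT «some `κ(m, n ∪ {q₁, q₂})` detected above `q₂` ⟹ some `κ(m', n) ≠ 0`», BASE CASE «total rank of `Sel(∅, n)` one ⟹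
`κ(∅, n) ≠ 0`», and `κ = 0` off the cores.

HONEST FRAMING: pure linear algebra + combinatorics (Mathlib `Submodule`, `finrank`, `Finset`); 0 definitions, 0 named facts,
0 `sorry`; (Twin) ∕ (Inert) ∕ (Lower) ∕ parity are HYPOTHESES, to be discharged E-side for the mixed spaces of a ♯ frame (typing of
`levelSelmerSubgroupP n ↑m μ ⊓ ⨅ transverseLocalKerP`, next files). It says nothing about level `∅` (where the crux's realisation and
seed live) and nothing about which frames carry a seed. BSD is not proved by any of this; KS′ is not proved by this.

References: [cite: Howard2004HeegnerKolyvagin, Lemma 2.5.3, Lemma 2.6.4] [cite: Howard2006Bipartite, Lemma 2.3.3, Cor. 2.3.5]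
[cite: WZhang2014, Lemma 5.3, Prop. 5.4, Thm. 4.3, Thm. 7.2, §8.1 (8.1), §9 (9.2)] [cite: MazurRubin2004, §4.4].
-/

noncomputable section
open scoped Classical
namespace Summit.BirchSwinnertonDyer.Rank1Residual.X11b.Three.Koly.CoreGraph

open Module
variable {F : Type*} [Field F] {H : Type*} [AddCommGroup H] [Module F H]

/-! ## §0 Parity bookkeeping -/
/-- `n.bodd = false ↔ n` is even. [folklore] -/
theorem bodd_eq_false_iff_even_nat (n : ℕ) : n.bodd = false ↔ Even n := by
  rw [Nat.even_iff, Nat.mod_two_of_bodd]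
  cases n.bodd <;> simp

/-- `n.bodd = true ↔ n` is odd. [folklore] -/
theorem bodd_eq_true_iff_odd_nat (n : ℕ) : n.bodd = true ↔ Odd n := by
  rw [← Nat.not_even_iff_odd, ← bodd_eq_false_iff_even_nat]
  cases n.bodd <;> simp

/-! ## §1 One Kolyvagin step in one sign: the twin dichotomy's bookkeeping -/
section Twin
variable {A B : Submodule F H} {T : H → Prop}

/-- **Not both sides of a Kolyvagin step are detected** (Howard 2004 Lemma 2.5.3 (a), bookkeeping form): if the smaller space is
the locally-trivial part of the larger whenever the larger has a detected class, then a detected class on one side makes every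
class of the other side locally trivial. [cite: Howard2004HeegnerKolyvagin, Lemma 2.5.3] -/
theorem twin_forall_triv_of_detected
    (hDrop : (∃ x ∈ A, ¬ T x) → (∀ y, y ∈ B ↔ (y ∈ A ∧ T y)) ∧ finrank F B + 1 = finrank F A)
    (hx : ∃ x ∈ A, ¬ T x) : ∀ y ∈ B, T y :=
  fun y hy ↦ (((hDrop hx).1 y).mp hy).2

/-- **The ranks on the two sides of a Kolyvagin step differ by exactly one** (Howard 2004 Lemma 2.5.3: `ρ(nℓ)^± = ρ(n)^± ∓ 1`),
from the two bookkeeping implications and the jump «one side has a detected class». [cite: Howard2004HeegnerKolyvagin, Lemma 2.5.3] -/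
theorem twin_rank_cases
    (hDrop : (∃ x ∈ A, ¬ T x) → (∀ y, y ∈ B ↔ (y ∈ A ∧ T y)) ∧ finrank F B + 1 = finrank F A)
    (hRise : (∃ y ∈ B, ¬ T y) → (∀ x, x ∈ A ↔ (x ∈ B ∧ T x)) ∧ finrank F A + 1 = finrank F B)
    (hJump : (∃ x ∈ A, ¬ T x) ∨ (∃ y ∈ B, ¬ T y)) :
    finrank F B + 1 = finrank F A ∨ finrank F A + 1 = finrank F B := by
  rcases hJump with hx | hy
  · exact Or.inl (hDrop hx).2
  · exact Or.inr (hRise hy).2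

/-- Parity form of `twin_rank_cases`: the rank parities on the two sides of a Kolyvagin step are opposite.
[cite: Howard2004HeegnerKolyvagin, Lemma 2.5.3] -/
theorem twin_bodd_eq_not
    (hDrop : (∃ x ∈ A, ¬ T x) → (∀ y, y ∈ B ↔ (y ∈ A ∧ T y)) ∧ finrank F B + 1 = finrank F A)
    (hRise : (∃ y ∈ B, ¬ T y) → (∀ x, x ∈ A ↔ (x ∈ B ∧ T x)) ∧ finrank F A + 1 = finrank F B)
    (hJump : (∃ x ∈ A, ¬ T x) ∨ (∃ y ∈ B, ¬ T y)) :
    (finrank F B).bodd = !(finrank F A).bodd := by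
  rcases twin_rank_cases hDrop hRise hJump with h | h
  · rw [← h, Nat.bodd_succ, Bool.not_not]
  · rw [← h, Nat.bodd_succ]

/-- A line is locally trivial as soon as its generator is, for a predicate closed under scalars. [folklore] -/
theorem forall_triv_of_generator (hTsmul : ∀ (c : F) (x : H), T x → T (c • x)) {a : H}
    (hgen : ∀ y ∈ A, ∃ c : F, c • a = y) (ha : T a) : ∀ y ∈ A, T y := by
  intro y hy
  obtain ⟨c, rfl⟩ := hgen y hy
  exact hTsmul c a ha
end Twin
/-! ## §2 Rank parity along the conductor direction -/
section Parity
variable {M Q : Type*} [DecidableEq M]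
  (Sel : Finset M → Finset Q → Bool → Submodule F H) (TM : M → H → Prop)

/-- **Per-sign rank parity along the conductor** (Howard 2004 Lemma 2.5.3: each Kolyvagin prime moves EACH signed rank by one):
at a level `n` where the twin dichotomy holds for every conductor, `bodd (dim Sel(m, n)^μ) = bodd (dim Sel(∅, n)^μ) xor bodd #m`.
[cite: Howard2004HeegnerKolyvagin, Lemma 2.5.3] -/
theorem bodd_finrank_eq (n : Finset Q)
    (hDrop : ∀ (m : Finset M) (ℓ : M) (μ : Bool), ℓ ∉ m → (∃ x ∈ Sel m n μ, ¬ TM ℓ x) →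
      (∀ y, y ∈ Sel (insert ℓ m) n μ ↔ (y ∈ Sel m n μ ∧ TM ℓ y)) ∧
        finrank F (Sel (insert ℓ m) n μ) + 1 = finrank F (Sel m n μ))
    (hRise : ∀ (m : Finset M) (ℓ : M) (μ : Bool), ℓ ∉ m → (∃ y ∈ Sel (insert ℓ m) n μ, ¬ TM ℓ y) →
      (∀ x, x ∈ Sel m n μ ↔ (x ∈ Sel (insert ℓ m) n μ ∧ TM ℓ x)) ∧
        finrank F (Sel m n μ) + 1 = finrank F (Sel (insert ℓ m) n μ))
    (hJump : ∀ (m : Finset M) (ℓ : M) (μ : Bool), ℓ ∉ m →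
      (∃ x ∈ Sel m n μ, ¬ TM ℓ x) ∨ (∃ y ∈ Sel (insert ℓ m) n μ, ¬ TM ℓ y))
    (m : Finset M) (μ : Bool) :
    (finrank F (Sel m n μ)).bodd = ((finrank F (Sel ∅ n μ)).bodd ^^ m.card.bodd) := by
  induction m using Finset.induction_on with
  | empty => simp only [Finset.card_empty, Nat.bodd_zero, Bool.xor_false]
  | insert ℓ m hℓm ih =>
    rw [Finset.card_insert_of_notMem hℓm, twin_bodd_eq_not (hDrop m ℓ μ hℓm) (hRise m ℓ μ hℓm) (hJump m ℓ μ hℓm), ih,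
      Nat.bodd_succ]
    cases (finrank F (Sel ∅ n μ)).bodd <;> cases m.card.bodd <;> rfl

/-- **The total rank parity is constant along the conductor** (each Kolyvagin prime moves both signed ranks by one).
[cite: Howard2004HeegnerKolyvagin, Lemma 2.5.3] -/
theorem even_total_iff (n : Finset Q)
    (hDrop : ∀ (m : Finset M) (ℓ : M) (μ : Bool), ℓ ∉ m → (∃ x ∈ Sel m n μ, ¬ TM ℓ x) →
      (∀ y, y ∈ Sel (insert ℓ m) n μ ↔ (y ∈ Sel m n μ ∧ TM ℓ y)) ∧
        finrank F (Sel (insert ℓ m) n μ) + 1 = finrank F (Sel m n μ))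
    (hRise : ∀ (m : Finset M) (ℓ : M) (μ : Bool), ℓ ∉ m → (∃ y ∈ Sel (insert ℓ m) n μ, ¬ TM ℓ y) →
      (∀ x, x ∈ Sel m n μ ↔ (x ∈ Sel (insert ℓ m) n μ ∧ TM ℓ x)) ∧
        finrank F (Sel m n μ) + 1 = finrank F (Sel (insert ℓ m) n μ))
    (hJump : ∀ (m : Finset M) (ℓ : M) (μ : Bool), ℓ ∉ m →
      (∃ x ∈ Sel m n μ, ¬ TM ℓ x) ∨ (∃ y ∈ Sel (insert ℓ m) n μ, ¬ TM ℓ y))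
    (m : Finset M) :
    Even (finrank F (Sel m n true) + finrank F (Sel m n false)) ↔
      Even (finrank F (Sel ∅ n true) + finrank F (Sel ∅ n false)) := by
  rw [← bodd_eq_false_iff_even_nat, ← bodd_eq_false_iff_even_nat, Nat.bodd_add, Nat.bodd_add,
    bodd_finrank_eq Sel TM n hDrop hRise hJump m true, bodd_finrank_eq Sel TM n hDrop hRise hJump m false]
  cases (finrank F (Sel ∅ n true)).bodd <;> cases (finrank F (Sel ∅ n false)).bodd <;> cases m.card.bodd <;> simp
end Parity
/-! ## §3 Canonical lines at the upper levels -/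
section Canonical
variable {M Q : Type*} [DecidableEq M] [DecidableEq Q]
  (Sel : Finset M → Finset Q → Bool → Submodule F H) (TM : M → H → Prop) (TQ : Q → H → Prop) (ε : Q → Bool)

/-- **Detection crosses a Kolyvagin step between canonical generators** (the heart of `relation` (8.1) for canonical lines;
Howard 2004 Lemma 2.5.3 twice): let `A^±`, `B^±` be the two sides of a Kolyvagin step (in both signs), `a` CANONICAL for `A`
(a generator of the rank-one sign when the total rank of `A` is one, else `0`) and `b` canonical for `B`. If `a` is detected
above the prime then so is `b`: `a ≠ 0` makes `A` a core spanned by `a` in a sign `μ`; the step DROPS in sign `μ` (to `0`) and —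
`A^{¬μ} = 0` having no detected class — RISES in sign `¬μ` (to a line with a detected class), so `B` is a core in sign `¬μ` and
its generator `b` is detected. [cite: Howard2004HeegnerKolyvagin, Lemma 2.5.3] [cite: WZhang2014, §8.1 (8.1)] -/
theorem not_triv_of_not_triv_canonical {A B : Bool → Submodule F H} {T : H → Prop}
    (hT0 : T 0) (hTsmul : ∀ (c : F) (x : H), T x → T (c • x))
    (hDrop : ∀ μ, (∃ x ∈ A μ, ¬ T x) → (∀ y, y ∈ B μ ↔ (y ∈ A μ ∧ T y)) ∧ finrank F (B μ) + 1 = finrank F (A μ))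
    (hRise : ∀ μ, (∃ y ∈ B μ, ¬ T y) → (∀ x, x ∈ A μ ↔ (x ∈ B μ ∧ T x)) ∧ finrank F (A μ) + 1 = finrank F (B μ))
    (hJump : ∀ μ, (∃ x ∈ A μ, ¬ T x) ∨ (∃ y ∈ B μ, ¬ T y))
    {a b : H} {μa μb : Bool}
    (ha : finrank F (A true) + finrank F (A false) = 1 →
      finrank F (A μa) = 1 ∧ A (!μa) = ⊥ ∧ a ∈ A μa ∧ a ≠ 0 ∧ ∀ y ∈ A μa, ∃ c : F, c • a = y)
    (ha0 : finrank F (A true) + finrank F (A false) ≠ 1 → a = 0)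
    (hb : finrank F (B true) + finrank F (B false) = 1 →
      finrank F (B μb) = 1 ∧ B (!μb) = ⊥ ∧ b ∈ B μb ∧ b ≠ 0 ∧ ∀ y ∈ B μb, ∃ c : F, c • b = y)
    (hTa : ¬ T a) : ¬ T b := by
  -- `a ≠ 0`, so `A` is a core spanned by `a` in the sign `μa`
  have ha_ne : a ≠ 0 := fun h ↦ hTa (h ▸ hT0)
  have hA1 : finrank F (A true) + finrank F (A false) = 1 := by
    by_contra h
    exact ha_ne (ha0 h)
  obtain ⟨hAμ, hAnot, haA, -, -⟩ := ha hA1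
  -- sign `μa`: the step drops to rank `0`
  have hdropμ := (hDrop μa ⟨a, haA, hTa⟩).2
  rw [hAμ] at hdropμ
  have hB0 : finrank F (B μa) = 0 := by omega
  -- sign `¬μa`: `A^{¬μa} = 0` has no detected class, so the jump is on the `B` side and the step rises to rank `1`
  have hnoA : ¬ ∃ x ∈ A (!μa), ¬ T x := by
    rintro ⟨x, hx, hTx⟩
    rw [hAnot, Submodule.mem_bot] at hx
    exact hTx (hx ▸ hT0)
  obtain ⟨y, hyB, hTy⟩ : ∃ y ∈ B (!μa), ¬ T y := (hJump (!μa)).resolve_left hnoA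
  have hriseμ := (hRise (!μa) ⟨y, hyB, hTy⟩).2
  rw [hAnot, finrank_bot] at hriseμ
  have hB1 : finrank F (B (!μa)) = 1 := by omega
  -- so `B` is a core, spanned by `b` in the sign `μb = ¬μa`
  have hBtot : finrank F (B true) + finrank F (B false) = 1 := by
    revert hB0 hB1
    cases μa
    · change finrank F (B false) = 0 → finrank F (B true) = 1 → _
      omega
    · change finrank F (B true) = 0 → finrank F (B false) = 1 → _
      omega
  obtain ⟨hBμ, -, -, -, hbgen⟩ := hb hBtot
  have hμb : μb = !μa := by
    by_contra hne
    have : μb = μa := by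
      revert hne
      cases μa <;> cases μb <;> decide
    rw [this, hB0] at hBμ
    exact zero_ne_one hBμ
  subst hμb
  -- `y` is a multiple of `b`; if `b` were locally trivial so would be `y`
  exact fun hTb ↦ hTy (forall_triv_of_generator hTsmul hbgen hTb y hyB)

/-- **CANONICAL LINES inhabit the carrier's upper-level fields** (the crux-triage finding TRIAGE-r1-1 v17 §1 for crux KS′, in ENGINE
currency). Data: bi-indexed level spaces `Sel m n μ` (conductor `m`, level `n`, sign `μ`) over a field, finite-dimensional; predicates
`TM ℓ` ∕ `TQ q` «locally trivial above the Kolyvagin prime `ℓ` ∕ the admissible prime `q`», closed under `0` and scalars; the sign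
`ε q` of each admissible prime. Hypotheses: (Twin) at every NON-EMPTY level, every conductor `m ∌ ℓ` and each sign — `hDrop`, `hRise`
(the smaller side is the locally-trivial-above-`ℓ` part of the larger, codimension one) and `hJump` (one side has a class detected above
`ℓ`) [Howard 2004 Lemma 2.5.3]; (Inert) `Sel(m, n∪q)^{¬ε q} = Sel(m, n)^{¬ε q}` and `(¬ε q)`-classes are locally trivial above `q`
[W. Zhang (9.2)]; (Lower) at a detected admissible prime [W. Zhang Prop. 5.4, lowering half]; the «in» bookkeeping `hIn`; the PARITY of
the total rank at conductor `∅` (odd ⟺ even level). CONCLUSION: there are level signs `ε₀` and classes `κ m n` (a generator of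
`Sel(m, n)` when its total rank is one — a CORE —, else `0`) such that at every non-empty level: `κ m n ∈ Sel(m, n)^{ε₀ n xor bodd #m}`
(the carrier's `sign` ∕ membership rows), RELATION (8.1) two-sided across every Kolyvagin step, TRANSPORT («a class two admissible
primes up detected above the top prime ⟹ a non-zero class at the bottom»), BASE CASE at the cores of conductor `∅`, and vanishing
off the cores. No seed, no reciprocity law, no Kolyvagin class is used. [cite: Howard2004HeegnerKolyvagin, Lemma 2.5.3, Lemma 2.6.4]
[cite: Howard2006Bipartite, Lemma 2.3.3, Cor. 2.3.5] [cite: WZhang2014, Prop. 5.4, Thm. 4.3, Thm. 7.2, §8.1 (8.1), §9 (9.2)] -/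
theorem exists_canonicalUpperLevels
    (hfin : ∀ (m : Finset M) (n : Finset Q) (μ : Bool), Module.Finite F (Sel m n μ))
    (hTM0 : ∀ ℓ, TM ℓ 0) (hTMsmul : ∀ (ℓ : M) (c : F) (x : H), TM ℓ x → TM ℓ (c • x))
    (hTQ0 : ∀ q, TQ q 0) (hTQsmul : ∀ (q : Q) (c : F) (x : H), TQ q x → TQ q (c • x))
    (hDrop : ∀ (m : Finset M) (ℓ : M) (n : Finset Q) (μ : Bool), ℓ ∉ m → n.Nonempty → (∃ x ∈ Sel m n μ, ¬ TM ℓ x) →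
      (∀ y, y ∈ Sel (insert ℓ m) n μ ↔ (y ∈ Sel m n μ ∧ TM ℓ y)) ∧
        finrank F (Sel (insert ℓ m) n μ) + 1 = finrank F (Sel m n μ))
    (hRise : ∀ (m : Finset M) (ℓ : M) (n : Finset Q) (μ : Bool), ℓ ∉ m → n.Nonempty →
      (∃ y ∈ Sel (insert ℓ m) n μ, ¬ TM ℓ y) →
      (∀ x, x ∈ Sel m n μ ↔ (x ∈ Sel (insert ℓ m) n μ ∧ TM ℓ x)) ∧
        finrank F (Sel m n μ) + 1 = finrank F (Sel (insert ℓ m) n μ))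
    (hJump : ∀ (m : Finset M) (ℓ : M) (n : Finset Q) (μ : Bool), ℓ ∉ m → n.Nonempty →
      (∃ x ∈ Sel m n μ, ¬ TM ℓ x) ∨ (∃ y ∈ Sel (insert ℓ m) n μ, ¬ TM ℓ y))
    (hInert : ∀ (m : Finset M) (n : Finset Q) (q : Q), q ∉ n → Sel m (insert q n) (!ε q) = Sel m n (!ε q))
    (hInertT : ∀ (m : Finset M) (n : Finset Q) (q : Q) (y : H), y ∈ Sel m n (!ε q) → TQ q y)
    (hLower : ∀ (m : Finset M) (n : Finset Q) (q : Q), q ∉ n → (∃ x ∈ Sel m n (ε q), ¬ TQ q x) →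
      Sel m (insert q n) (ε q) ≤ Sel m n (ε q) ∧ finrank F (Sel m (insert q n) (ε q)) + 1 = finrank F (Sel m n (ε q)) ∧
      ∀ y ∈ Sel m (insert q n) (ε q), TQ q y)
    (hIn : ∀ (m : Finset M) (n : Finset Q) (q : Q) (μ : Bool) (y : H), q ∉ n → y ∈ Sel m n μ → TQ q y →
      y ∈ Sel m (insert q n) μ)
    (hpar : ∀ n : Finset Q, n.Nonempty →
      (Odd (finrank F (Sel ∅ n true) + finrank F (Sel ∅ n false)) ↔ Even n.card)) :
    ∃ (ε₀ : Finset Q → Bool) (κ : Finset M → Finset Q → H),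
      (∀ n : Finset Q, n.Nonempty → ∀ m : Finset M, κ m n ∈ Sel m n (ε₀ n ^^ m.card.bodd)) ∧
      (∀ n : Finset Q, n.Nonempty → ∀ (m : Finset M) (ℓ : M), ℓ ∉ m →
        (TM ℓ (κ (insert ℓ m) n) ↔ TM ℓ (κ m n))) ∧
      (∀ (n : Finset Q) (q₁ q₂ : Q), n.Nonempty → q₁ ∉ n → q₂ ∉ insert q₁ n →
        (∃ m, ¬ TQ q₂ (κ m (insert q₂ (insert q₁ n)))) → ∃ m, κ m n ≠ 0) ∧
      (∀ n : Finset Q, n.Nonempty → finrank F (Sel ∅ n true) + finrank F (Sel ∅ n false) = 1 → κ ∅ n ≠ 0) ∧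
      (∀ (n : Finset Q) (m : Finset M), finrank F (Sel m n true) + finrank F (Sel m n false) ≠ 1 → κ m n = 0) := by
  -- the canonical choice: a generator at the cores, `0` elsewhere
  have key : ∀ (m : Finset M) (n : Finset Q), ∃ (x : H) (μ : Bool),
      (finrank F (Sel m n true) + finrank F (Sel m n false) = 1 →
        finrank F (Sel m n μ) = 1 ∧ Sel m n (!μ) = ⊥ ∧ x ∈ Sel m n μ ∧ x ≠ 0 ∧ ∀ y ∈ Sel m n μ, ∃ c : F, c • x = y) ∧
      (finrank F (Sel m n true) + finrank F (Sel m n false) ≠ 1 → x = 0) := by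
    intro m n
    by_cases h1 : finrank F (Sel m n true) + finrank F (Sel m n false) = 1
    · obtain ⟨μ, s, h⟩ := exists_generator_of_total_eq_one (Sel m) (hfin m) h1
      exact ⟨s, μ, fun _ ↦ h, fun h ↦ absurd h1 h⟩
    · exact ⟨0, true, fun h ↦ absurd h h1, fun _ ↦ rfl⟩
  choose κ μ₀ hcore hzero using key
  refine ⟨fun n ↦ (finrank F (Sel ∅ n true)).bodd, κ, ?_, ?_, ?_, ?_, fun n m h ↦ hzero m n h⟩
  · -- `sign` ∕ membership: the parity bookkeeping of §2 pins the core sign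
    intro n hn m
    by_cases h1 : finrank F (Sel m n true) + finrank F (Sel m n false) = 1
    · obtain ⟨hμ1, hnot, hmem, -, -⟩ := hcore m n h1
      have hpt := bodd_finrank_eq Sel TM n (fun m ℓ μ hℓ ↦ hDrop m ℓ n μ hℓ hn) (fun m ℓ μ hℓ ↦ hRise m ℓ n μ hℓ hn)
        (fun m ℓ μ hℓ ↦ hJump m ℓ n μ hℓ hn) m true
      have hsign : μ₀ m n = ((finrank F (Sel ∅ n true)).bodd ^^ m.card.bodd) := by
        revert hpt
        cases hμ : μ₀ m n
        · -- `μ₀ = false`: `Sel m n true = ⊥`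
          have ht : finrank F (Sel m n true) = 0 := by
            have := hnot; rw [hμ] at this; change Sel m n true = ⊥ at this; rw [this, finrank_bot]
          rw [ht]
          cases (finrank F (Sel ∅ n true)).bodd <;> cases m.card.bodd <;> decide
        · have ht : finrank F (Sel m n true) = 1 := by rw [hμ] at hμ1; exact hμ1
          rw [ht]
          cases (finrank F (Sel ∅ n true)).bodd <;> cases m.card.bodd <;> decide
      rw [← hsign]
      exact hmem
    · rw [hzero m n h1]
      exact Submodule.zero_mem _
  · -- `relation` (8.1), both directions, by `not_triv_of_not_triv_canonical` and its mirror image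
    intro n hn m ℓ hℓ
    constructor
    · intro h
      by_contra hc
      exact (not_triv_of_not_triv_canonical (A := Sel m n) (B := Sel (insert ℓ m) n) (hTM0 ℓ) (hTMsmul ℓ)
        (fun μ ↦ hDrop m ℓ n μ hℓ hn) (fun μ ↦ hRise m ℓ n μ hℓ hn) (fun μ ↦ hJump m ℓ n μ hℓ hn)
        (hcore m n) (hzero m n) (hcore (insert ℓ m) n) hc) h
    · intro h
      by_contra hc
      exact (not_triv_of_not_triv_canonical (A := Sel (insert ℓ m) n) (B := Sel m n) (hTM0 ℓ) (hTMsmul ℓ)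
        (fun μ h' ↦ hRise m ℓ n μ hℓ hn h') (fun μ h' ↦ hDrop m ℓ n μ hℓ hn h')
        (fun μ ↦ (hJump m ℓ n μ hℓ hn).symm) (hcore (insert ℓ m) n) (hzero (insert ℓ m) n) (hcore m n) hc) h
  · -- `transport`: a class two primes up detected above the top prime forces a core at the bottom of the same conductor
    intro n q₁ q₂ hn hq₁ hq₂ hdet
    obtain ⟨m, hm⟩ := hdet
    set N₁ := insert q₁ n with hN₁
    set N₂ := insert q₂ N₁ with hN₂
    have hq₂N₁ : q₂ ∉ N₁ := hq₂
    -- the top is a core spanned by the detected class, in the sign `ε q₂`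
    have htop_ne : κ m N₂ ≠ 0 := fun h ↦ hm (h ▸ hTQ0 q₂)
    have htop1 : finrank F (Sel m N₂ true) + finrank F (Sel m N₂ false) = 1 := by
      by_contra h
      exact htop_ne (hzero m N₂ h)
    obtain ⟨hμ1, hnot, hmem, -, hgen⟩ := hcore m N₂ htop1
    have hμε : μ₀ m N₂ = ε q₂ := by
      by_contra hne
      have h' : μ₀ m N₂ = !ε q₂ := by
        revert hne
        cases μ₀ m N₂ <;> cases ε q₂ <;> decide
      exact hm (hInertT m N₂ q₂ _ (h' ▸ hmem))
    -- one prime down: the sign `ε q₂` is zero (no detected class below, and the line above is detected), the other sign is `0` too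
    have hmid_ε : Sel m N₁ (ε q₂) = ⊥ := by
      have hall : ∀ x ∈ Sel m N₁ (ε q₂), TQ q₂ x := by
        intro x hx
        by_contra hTx
        exact hm ((hLower m N₁ q₂ hq₂N₁ ⟨x, hx, hTx⟩).2.2 _ (hμε ▸ hmem))
      have hle : Sel m N₁ (ε q₂) ≤ Sel m N₂ (ε q₂) := fun x hx ↦ hIn m N₁ q₂ (ε q₂) x hq₂N₁ hx (hall x hx)
      by_contra hne
      obtain ⟨x, hx, hx0⟩ := (Submodule.ne_bot_iff _).mp hne
      -- `x` is a non-zero multiple of the detected generator, hence detected: contradiction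
      obtain ⟨c, hc⟩ := hgen x (hμε ▸ hle hx)
      have hc0 : c ≠ 0 := by
        rintro rfl
        exact hx0 (by rw [← hc, zero_smul])
      have : TQ q₂ (κ m N₂) := by
        have h := hTQsmul q₂ c⁻¹ x (hall x hx)
        rwa [← hc, smul_smul, inv_mul_cancel₀ hc0, one_smul] at h
      exact hm this
    have hmid_ν : Sel m N₁ (!ε q₂) = ⊥ := by
      rw [← hInert m N₁ q₂ hq₂N₁]
      have := hnot
      rw [hμε] at this
      exact this
    have hmid0 : finrank F (Sel m N₁ true) + finrank F (Sel m N₁ false) = 0 := by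
      rw [← finrank_add_finrank_not (Sel m) N₁ (ε q₂), hmid_ε, hmid_ν, finrank_bot]
    -- the bottom: in the sign `¬ε q₁` it equals the middle (`0`); in the sign `ε q₁` it is a line iff a class is detected
    have hbot_ν : Sel m n (!ε q₁) = ⊥ := by
      rw [← hInert m n q₁ hq₁]
      rcases Bool.eq_false_or_eq_true (ε q₂) with h2 | h2 <;> rcases Bool.eq_false_or_eq_true (ε q₁) with h1 | h1
      all_goals first
        | (rw [h1]; rw [h2] at hmid_ε hmid_ν; first | exact hmid_ε | exact hmid_ν)
    by_cases hdet₁ : ∃ x ∈ Sel m n (ε q₁), ¬ TQ q₁ x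
    · -- detected: (Lower) gives rank exactly one at the bottom, a core
      obtain ⟨-, hrank, -⟩ := hLower m n q₁ hq₁ hdet₁
      have hN₁ε : finrank F (Sel m N₁ (ε q₁)) = 0 := by
        have h := hmid0
        rw [← finrank_add_finrank_not (Sel m) N₁ (ε q₁)] at h
        omega
      have hbot1 : finrank F (Sel m n true) + finrank F (Sel m n false) = 1 := by
        rw [← finrank_add_finrank_not (Sel m) n (ε q₁), hbot_ν, finrank_bot, ← hrank, hN₁ε]
      exact ⟨m, (hcore m n hbot1).2.2.2.1⟩
    · -- undetected: the bottom would have total rank `0` at an even level and the top rank `1` two primes up — parity forbids it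
      exfalso
      push Not at hdet₁
      have hle : Sel m n (ε q₁) ≤ Sel m N₁ (ε q₁) := fun x hx ↦ hIn m n q₁ (ε q₁) x hq₁ hx (hdet₁ x hx)
      have hN₁ε : Sel m N₁ (ε q₁) = ⊥ := by
        haveI := hfin m N₁ (ε q₁)
        refine Submodule.finrank_eq_zero.mp ?_
        have h := hmid0
        rw [← finrank_add_finrank_not (Sel m) N₁ (ε q₁)] at h
        omega
      have hbot_ε : Sel m n (ε q₁) = ⊥ := le_bot_iff.mp (hN₁ε ▸ hle)
      have hbot0 : finrank F (Sel m n true) + finrank F (Sel m n false) = 0 := by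
        rw [← finrank_add_finrank_not (Sel m) n (ε q₁), hbot_ε, hbot_ν, finrank_bot]
      -- parity at conductor `m` = parity at conductor `∅` (§2), which is «odd ⟺ even level»
      have hparm : ∀ N : Finset Q, N.Nonempty → (Even (finrank F (Sel m N true) + finrank F (Sel m N false)) ↔
          Even (finrank F (Sel ∅ N true) + finrank F (Sel ∅ N false))) := fun N hN ↦
        even_total_iff Sel TM N (fun m ℓ μ hℓ ↦ hDrop m ℓ N μ hℓ hN) (fun m ℓ μ hℓ ↦ hRise m ℓ N μ hℓ hN)
          (fun m ℓ μ hℓ ↦ hJump m ℓ N μ hℓ hN) m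
      have hN₂ne : N₂.Nonempty := Finset.insert_nonempty q₂ N₁
      have hcard : N₂.card = n.card + 2 := by
        rw [hN₂, Finset.card_insert_of_notMem hq₂N₁, hN₁, Finset.card_insert_of_notMem hq₁]
      -- bottom even total (`0`) ⟹ `#n` odd; top odd total (`1`) ⟹ `#n + 2` even
      have h1 : ¬ Even n.card := by
        rw [← hpar n hn, ← Nat.not_even_iff_odd, ← hparm n hn, hbot0]
        simp
      have h2 : Even N₂.card := by
        rw [← hpar N₂ hN₂ne, ← Nat.not_even_iff_odd, ← hparm N₂ hN₂ne, htop1]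
        simp
      rw [hcard, Nat.even_add] at h2
      exact h1 (h2.mpr (by decide))
  · -- `baseCase`: at a core of conductor `∅` the canonical class is a generator
    intro n _ h1
    exact (hcore ∅ n h1).2.2.2.1
end Canonical
end Summit.BirchSwinnertonDyer.Rank1Residual.X11b.Three.Koly.CoreGraph

end
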